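import Mathlib
import HarnessLib
import Summits.NavierStokesRegularity.NavierStokesRegularity.Theorems.PeepholeEchoDoorResidues

/-!
# PeepholeEchoDoorDoors — S23 «PeepholeEchoDoor» (two-time peephole doors), part 4/4

§4′ the echo residue in the decay class FROM THE WALL `Literature.Analysis.FluidPDE.TypeIDSSLiouville (√κ)⁻¹` (`echoResidueDecayAt_of_wall`) and near one by Chae–Wolf 2017 Thm 1.3 (`echoResidueDecayAt_nearOne`), and §5 the doors: `closesOneRatio`, T1 `targetOffDiagonal_holds`, T2 `targetAllRatios_holds`, T3 `targetKronecker_holds`, T4-D `targetEchoDecay_of_wall` / `targetEchoDecay_of_conjecture`, T5 `targetNearOneEcho_holds`.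

Door family of LADDER-NS N0 (local Type-I window doors S20/S21-C/S22/S23); THEOREMS-ONLY landing of the nsreg-p1 design
`run/shared/lean/pub/ns-regularity-ideate/ns-regularity-ideate-p1/r22/Sketch23.lean` (ROUND-22.md). Conditional door
theorems: they EVADE hard core 10661 by hypothesis (T1/T2/T3/T5) or MEET it at the named wall (T4-D); no route, no items
(DIRECTOR-NS standing #32 (2)). WHAT THIS IS NOT: not a regularity claim; not an attack on `TypeIDSSLiouville`.
-/

noncomputable section

set_option linter.dupNamespace false

namespace Summit.NavierStokesRegularity.NavierStokesRegularity.Theorems.PeepholeEchoDoorDoors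

open MeasureTheory Set Function Filter Topology TopologicalSpace Metric
open scoped RealInnerProductSpace NNReal ENNReal Topology Pointwise
open Literature.Analysis Literature.Analysis.FluidPDE
open Summit.NavierStokesRegularity.NavierStokesRegularity.Theorems.LocalSineTubeDoorProfileAlignedWindowRigidityAncient
open Summit.NavierStokesRegularity.NavierStokesRegularity.Theorems.PoloidalWindowDoorPoloidalWindowRigidityStrata
open Summit.NavierStokesRegularity.NavierStokesRegularity.Theorems.PoloidalWindowDoorPoloidalWindowRigidityFlat
open Summit.NavierStokesRegularity.NavierStokesRegularity.Theorems.PoloidalWindowDoorPoloidalWindowRigidityWindow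
open Summit.NavierStokesRegularity.NavierStokesRegularity.Theorems.PeepholeEchoDoorDefs
open Summit.NavierStokesRegularity.NavierStokesRegularity.Theorems.PeepholeEchoDoorCore
open Summit.NavierStokesRegularity.NavierStokesRegularity.Theorems.PeepholeEchoDoorResidues

section Residues

variable {C : ℝ} {v : ℝ → EuclideanSpace ℝ (Fin 3) → EuclideanSpace ℝ (Fin 3)}

/-! ### The echo residue in the decay class: the wall by name, and Chae–Wolf near one -/

/-- Cutting a field off at `t ≥ 0` (the wall's DSS relation is stated at all times). -/
def pastCut (v : ℝ → EuclideanSpace ℝ (Fin 3) → EuclideanSpace ℝ (Fin 3)) :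
    ℝ → EuclideanSpace ℝ (Fin 3) → EuclideanSpace ℝ (Fin 3) :=
  fun t x => if t < 0 then v t x else 0

/-- `pastCut v` agrees with `v` at negative times. -/
theorem pastCut_of_neg {t : ℝ} (ht : t < 0) : pastCut v t = v t := funext fun _ => if_pos ht

/-- `pastCut v` vanishes at times `t ≥ 0`. -/
theorem pastCut_of_not_neg {t : ℝ} (ht : ¬ t < 0) : pastCut v t = 0 := funext fun _ => if_neg ht

/-- The Oseen-gauge class only sees negative times (cf. tree `isTypeIAncientMild_congr_neg`). -/
theorem isTypeIAncientMild_pastCut (hv : IsTypeIAncientMild C v) : IsTypeIAncientMild C (pastCut v) := by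
  refine ⟨?_, fun t ht => ?_, fun s t hst ht x => ?_, fun t ht x => ?_⟩
  · refine hv.contDiffOn.congr fun q hq => ?_
    rcases q with ⟨t, x⟩
    have ht : t < 0 := (mem_prod.1 hq).1
    simp only [uncurry_apply_pair, pastCut, if_pos ht]
  · rw [pastCut_of_neg ht]
    exact hv.isDivFree ht
  · rw [pastCut_of_neg ht, pastCut_of_neg (hst.trans ht)]
    have e : oseenDuhamel 1 s (pastCut v) (pastCut v) t x = oseenDuhamel 1 s v v t x := by
      simp only [oseenDuhamel]
      refine setIntegral_congr_fun measurableSet_Ioo fun τ hτ => ?_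
      simp only [pastCut_of_neg (hτ.2.trans ht)]
    rw [e]
    exact hv.mild_eq hst ht x
  · rw [pastCut_of_neg ht]
    exact hv.norm_le ht x

/-- An echo at ratio `κ ∈ (0,1)` on the slab makes the cut-off field `(√κ)⁻¹`-DSS at all times. -/
theorem isDiscretelySelfSimilar_pastCut {κ : ℝ} (hκ : 0 < κ) (h : HasTwoPointSymmetry κ (Real.sqrt κ) v) :
    IsDiscretelySelfSimilar (Real.sqrt κ)⁻¹ (pastCut v) := by
  have hsκ : 0 < Real.sqrt κ := Real.sqrt_pos.2 hκ
  have hc2 : ((Real.sqrt κ)⁻¹) ^ 2 = κ⁻¹ := by rw [inv_pow, Real.sq_sqrt hκ.le]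
  have hinv := h.inv hκ hsκ
  unfold IsDiscretelySelfSimilar
  funext t x
  rw [nsRescale_apply, hc2]
  by_cases ht : t < 0
  · have hκt : κ⁻¹ * t < 0 := mul_neg_of_pos_of_neg (inv_pos.2 hκ) ht
    rw [pastCut_of_neg ht, pastCut_of_neg hκt]
    exact (hinv t ht x).symm
  · have hκt : ¬ κ⁻¹ * t < 0 := fun h' => ht (by
      rcases lt_or_ge t 0 with h1 | h1
      · exact h1
      · exact absurd h' (not_lt.2 (mul_nonneg (inv_pos.2 hκ).le h1)))
    rw [pastCut_of_not_neg ht, pastCut_of_not_neg hκt]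
    simp

/-- A field with a NONPOSITIVE decay constant vanishes. -/
theorem eq_zero_of_hasTypeIDecay_nonpos {D : ℝ} (hD : D ≤ 0) (h : HasTypeIDecay D v) :
    ∀ t < 0, ∀ x, v t x = 0 := by
  intro t ht x
  have hden : 0 < ‖x‖ + Real.sqrt (-t) := add_pos_of_nonneg_of_pos (norm_nonneg _) (Real.sqrt_pos.2 (neg_pos.2 ht))
  have h1 : ‖v t x‖ ≤ 0 := (h t ht x).trans (div_nonpos_iff.2 (Or.inr ⟨hD, hden.le⟩))
  exact norm_eq_zero.1 (le_antisymm h1 (norm_nonneg _))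

/-- From slice-wise a.e. vanishing to vanishing, for door-class profiles (continuous slices). -/
theorem eq_zero_of_ae (hrate : HasTypeITimeDecay C v) (hcont : ContinuousOn (uncurry v) (Iio (0 : ℝ) ×ˢ univ))
    (hmild : ∀ s t : ℝ, s < t → t < 0 → ∀ x,
      v t x = UnboundedOperators.heatExtension (v s) (t - s) x - oseenDuhamel 1 s v v t x)
    (hae : ∀ t < 0, v t =ᵐ[volume] 0) : ∀ t < 0, ∀ x, v t x = 0 := by
  intro t ht x
  have hc : Continuous (v t) := by
    rw [← continuousOn_univ]
    exact (analyticOnNhd_slice hcont (bdd_of_hasTypeITimeDecay hrate) hmild ht).continuousOn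
  have h0 : v t = 0 := (Continuous.ae_eq_iff_eq volume hc continuous_zero).1 (hae t ht)
  rw [h0]
  rfl

/-- **BRIDGE TO THE WALL (PROVED).**  For `κ ∈ (0,1)` the wall `TypeIDSSLiouville (√κ)⁻¹` (Bradshaw–Tsai Open
Problem 5.1, tree `Literature.Analysis.FluidPDE.TypeIDSSLiouville`) implies the echo residue in the decay class at
every decay constant: the door class lies in the KNSS Type-I ancient mild class (`isTypeIAncientMild_of_class`), hence
in the wall's duality-mild class (`IsTypeIAncientMild.isAncientMildSolution`), after cutting off `t ≥ 0`. -/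
theorem echoResidueDecayAt_of_wall {κ : ℝ} (hκ : 0 < κ) (hκ1 : κ < 1)
    (hwall : TypeIDSSLiouville (Real.sqrt κ)⁻¹) (D : ℝ) : EchoResidueDecayAt D κ := by
  intro C v hrate hdecay hcont hmild hdiv hsym hsing
  have hsκ : 0 < Real.sqrt κ := Real.sqrt_pos.2 hκ
  have hsκ1 : Real.sqrt κ < 1 := by
    have h := Real.sqrt_lt_sqrt hκ.le hκ1
    rwa [Real.sqrt_one] at h
  have hc1 : 1 < (Real.sqrt κ)⁻¹ := (one_lt_inv₀ hsκ).2 hsκ1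
  have hclass : IsTypeIAncientMild C (pastCut v) :=
    isTypeIAncientMild_pastCut (isTypeIAncientMild_of_class hrate hcont hmild hdiv)
  have hmeas : ∀ t < 0, AEStronglyMeasurable (pastCut v t) volume := by
    intro t ht
    rw [pastCut_of_neg ht]
    have hc : Continuous (v t) := by
      rw [← continuousOn_univ]
      exact (analyticOnNhd_slice hcont (bdd_of_hasTypeITimeDecay hrate) hmild ht).continuousOn
    exact hc.aestronglyMeasurable
  have hdec' : ∃ C₀ : ℝ, HasTypeIDecay C₀ (pastCut v) :=
    ⟨D, fun t ht x => by rw [pastCut_of_neg ht]; exact hdecay t ht x⟩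
  have hae := hwall hc1 (pastCut v) hclass.isAncientMildSolution hmeas (isDiscretelySelfSimilar_pastCut hκ hsym) hdec'
  have hae' : ∀ t < 0, v t =ᵐ[volume] 0 := fun t ht => by
    have h := hae t ht
    rwa [pastCut_of_neg ht] at h
  exact not_backwardSingular_of_zero (eq_zero_of_ae hrate hcont hmild hae') hsing

/-- The same for every decay constant. -/
theorem echoResidueDecay_of_wall {κ : ℝ} (hκ : 0 < κ) (hκ1 : κ < 1)
    (hwall : TypeIDSSLiouville (Real.sqrt κ)⁻¹) : EchoResidueDecay κ :=
  fun D => echoResidueDecayAt_of_wall hκ hκ1 hwall D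

/-- **NEAR-ONE ECHO RESIDUE (PROVED, Chae–Wolf 2017 Thm 1.3 = tree `chaeWolf2017_removing_dss_holds`).**  For every
decay constant `D` there is `κ₁ < 1` such that the echo residue in the decay class holds at every ratio `κ ∈ (κ₁, 1)`
(one smooth pressure on the slab from `exists_isClassicalNSSolutionOn_Iio_of_isTypeIAncientMild`). -/
theorem echoResidueDecayAt_nearOne (D : ℝ) :
    ∃ κ₁ : ℝ, 0 < κ₁ ∧ κ₁ < 1 ∧ ∀ κ : ℝ, κ₁ < κ → κ < 1 → EchoResidueDecayAt D κ := by
  rcases le_or_gt D 0 with hD | hD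
  · refine ⟨1 / 2, by norm_num, by norm_num, fun κ _ _ => ?_⟩
    intro C v hrate hdecay hcont hmild hdiv hsym hsing
    exact not_backwardSingular_of_zero (eq_zero_of_hasTypeIDecay_nonpos hD hdecay) hsing
  obtain ⟨c₁, hc₁, hcw⟩ := chaeWolf2017_removing_dss_holds D hD
  have hc₁pos : 0 < c₁ := zero_lt_one.trans hc₁
  have hc₁sq : 1 < c₁ ^ 2 := by nlinarith
  refine ⟨(c₁ ^ 2)⁻¹, by positivity, inv_lt_one_of_one_lt₀ hc₁sq, fun κ hκ₁ hκ1 => ?_⟩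
  have hκ : 0 < κ := (inv_pos.2 (zero_lt_one.trans hc₁sq)).trans hκ₁
  intro C v hrate hdecay hcont hmild hdiv hsym hsing
  have hsκ : 0 < Real.sqrt κ := Real.sqrt_pos.2 hκ
  have hsκ1 : Real.sqrt κ < 1 := by
    have h := Real.sqrt_lt_sqrt hκ.le hκ1
    rwa [Real.sqrt_one] at h
  have hc1 : 1 < (Real.sqrt κ)⁻¹ := (one_lt_inv₀ hsκ).2 hsκ1
  have hcc₁ : (Real.sqrt κ)⁻¹ < c₁ := by
    rw [inv_lt_comm₀ hsκ hc₁pos]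
    have h := Real.sqrt_lt_sqrt (inv_pos.2 (zero_lt_one.trans hc₁sq)).le hκ₁
    rwa [Real.sqrt_inv, Real.sqrt_sq hc₁pos.le] at h
  have hclass : IsTypeIAncientMild C (pastCut v) :=
    isTypeIAncientMild_pastCut (isTypeIAncientMild_of_class hrate hcont hmild hdiv)
  obtain ⟨q, hq⟩ :=
    Summit.NavierStokesRegularity.NavierStokesRegularity.Theorems.exists_isClassicalNSSolutionOn_Iio_of_isTypeIAncientMild
      hclass
  have hdecw : HasTypeIDecay D (pastCut v) := fun t ht x => by rw [pastCut_of_neg ht]; exact hdecay t ht x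
  have hzero := hcw _ hc1 hcc₁ (pastCut v) q hq (isDiscretelySelfSimilar_pastCut hκ hsym) hdecw
  have hzero' : ∀ t < 0, ∀ x, v t x = 0 := fun t ht x => by
    have h := hzero t ht x
    rwa [pastCut_of_neg ht] at h
  exact not_backwardSingular_of_zero hzero' hsing

end Residues

/-! ## §5 The doors -/

/-- **DOOR T1 PROVED** «no off-diagonal repetition»: K1 + the off-diagonal residue. -/
theorem targetOffDiagonal_holds : TargetOffDiagonal := by
  intro ν T hν hT u p hcl hLH hdec x₀ ρ M hρ hM κ μ hκ hμ hne U hU hUne hfade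
  by_contra hnot
  obtain ⟨C, v, hrate, hcont, hmild, hdiv, hsing, huniv⟩ :=
    localPointZoomTwoTime_holds ν T hν hT u p hcl hLH hdec x₀ ρ M hρ hM hnot
  have hsym := huniv κ μ hκ hμ U hU hUne hfade
  exact not_backwardSingular_of_zero (offDiagonalResidue_holds κ μ hκ hμ hne C v hrate hsym) hsing

/-- **DOOR T2 PROVED** «no total echo»: K1 + echoes at all ratios `κ ∈ (0,1)` extend to all ratios + the all-ratios residue. -/
theorem targetAllRatios_holds : TargetAllRatios := by
  intro ν T hν hT u p hcl hLH hdec x₀ ρ M hρ hM hall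
  by_contra hnot
  obtain ⟨C, v, hrate, hcont, hmild, hdiv, hsing, huniv⟩ :=
    localPointZoomTwoTime_holds ν T hν hT u p hcl hLH hdec x₀ ρ M hρ hM hnot
  have hsym : ∀ κ : ℝ, 0 < κ → κ < 1 → HasTwoPointSymmetry κ (Real.sqrt κ) v := by
    intro κ hκ hκ1
    obtain ⟨U, hU, hUne, hfade⟩ := hall κ hκ hκ1
    exact huniv κ (Real.sqrt κ) hκ (Real.sqrt_pos.2 hκ) U hU hUne hfade
  exact allRatiosResidue_holds C v hrate hcont hmild hdiv (hasTwoPointSymmetry_all_of_lt_one hsym) hsing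

/-- **DOOR T3 PROVED** «no two incommensurable echoes»: K1 + Kronecker density of `κ₁^m κ₂^{-n}` + the all-ratios residue. -/
theorem targetKronecker_holds : TargetKronecker := by
  intro ν T hν hT u p hcl hLH hdec x₀ ρ M hρ hM κ₁ κ₂ hκ₁ hκ₁1 hκ₂ hκ₂1 hirr U₁ U₂ hU₁ hU₁ne hU₂ hU₂ne hf₁ hf₂
  by_contra hnot
  obtain ⟨C, v, hrate, hcont, hmild, hdiv, hsing, huniv⟩ :=
    localPointZoomTwoTime_holds ν T hν hT u p hcl hLH hdec x₀ ρ M hρ hM hnot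
  have h₁ := huniv κ₁ (Real.sqrt κ₁) hκ₁ (Real.sqrt_pos.2 hκ₁) U₁ hU₁ hU₁ne hf₁
  have h₂ := huniv κ₂ (Real.sqrt κ₂) hκ₂ (Real.sqrt_pos.2 hκ₂) U₂ hU₂ hU₂ne hf₂
  exact allRatiosResidue_holds C v hrate hcont hmild hdiv
    (hasTwoPointSymmetry_all_of_two hcont hκ₁ hκ₁1 hκ₂ hκ₂1 hirr h₁ h₂) hsing

/-- The deciding theorem of the one-ratio door (glue `closesOneRatio`): K1 → K2(κ) → T4(κ). -/
theorem closesOneRatio (κ : ℝ) (hκ : 0 < κ) (h₁ : LocalPointZoomTwoTime) (h₂ : EchoResidue κ) : TargetEcho κ := by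
  intro ν T hν hT u p hcl hLH hdec x₀ ρ M hρ hM U hU hUne hfade
  by_contra hnot
  obtain ⟨C, v, hrate, hcont, hmild, hdiv, hsing, huniv⟩ := h₁ ν T hν hT u p hcl hLH hdec x₀ ρ M hρ hM hnot
  exact h₂ C v hrate hcont hmild hdiv (huniv κ (Real.sqrt κ) hκ (Real.sqrt_pos.2 hκ) U hU hUne hfade) hsing

/-- The assembly text `EchoAssembly κ` (K1 → K2(κ) → T4(κ)) holds for every `κ > 0`, by `closesOneRatio`. -/
theorem echoAssembly_holds (κ : ℝ) (hκ : 0 < κ) : EchoAssembly κ := fun h₁ h₂ => closesOneRatio κ hκ h₁ h₂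

/-- The one-ratio door is PROVED modulo the echo residue alone. -/
theorem closesEcho (κ : ℝ) (hκ : 0 < κ) (h₂ : EchoResidue κ) : TargetEcho κ :=
  closesOneRatio κ hκ localPointZoomTwoTime_holds h₂

/-- The decay version at constants `ν, M`: PROVED modulo `EchoResidueDecayAt (M/ν) κ`. -/
theorem closesEchoDecayAt (ν M κ : ℝ) (hν : 0 < ν) (hκ : 0 < κ) (h₂ : EchoResidueDecayAt (M / ν) κ) :
    TargetEchoDecayAt ν M κ := by
  intro T hT u p hcl hLH hdec x₀ ρ hρ hM U hU hUne hfade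
  by_contra hnot
  obtain ⟨C, v, hrate, hdecay, hcont, hmild, hdiv, hsing, huniv⟩ :=
    localPointZoomTwoTime_decay ν T hν hT u p hcl hLH hdec x₀ ρ M hρ hM hnot
  exact h₂ C v hrate hdecay hcont hmild hdiv (huniv κ (Real.sqrt κ) hκ (Real.sqrt_pos.2 hκ) U hU hUne hfade) hsing

/-- The decay version: PROVED modulo `EchoResidueDecay κ`. -/
theorem closesEchoDecay (κ : ℝ) (hκ : 0 < κ) (h₂ : EchoResidueDecay κ) : TargetEchoDecay κ :=
  fun ν M hν => closesEchoDecayAt ν M κ hν hκ (h₂ (M / ν))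

/-- **DOOR T4-D FROM THE WALL (PROVED bridge):** for `κ ∈ (0,1)`, `TypeIDSSLiouville (√κ)⁻¹ → TargetEchoDecay κ`. -/
theorem targetEchoDecay_of_wall {κ : ℝ} (hκ : 0 < κ) (hκ1 : κ < 1) (hwall : TypeIDSSLiouville (Real.sqrt κ)⁻¹) :
    TargetEchoDecay κ :=
  closesEchoDecay κ hκ (echoResidueDecay_of_wall hκ hκ1 hwall)

/-- … hence from the summit's canonical conjecture leaf `TypeIDSSLiouvilleConjecture` at every ratio in `(0,1)`. -/
theorem targetEchoDecay_of_conjecture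
    (h : Summit.NavierStokesRegularity.NavierStokesRegularity.TypeIDSSLiouvilleConjecture) {κ : ℝ} (hκ : 0 < κ)
    (hκ1 : κ < 1) : TargetEchoDecay κ :=
  targetEchoDecay_of_wall hκ hκ1 (h (Real.sqrt κ)⁻¹).1

/-- **DOOR T5 «no fine echo» (PROVED).** -/
theorem targetNearOneEcho_holds : TargetNearOneEcho := by
  intro ν M hν
  obtain ⟨κ₁, hκ₁, hκ₁1, hres⟩ := echoResidueDecayAt_nearOne (M / ν)
  exact ⟨κ₁, hκ₁1, fun κ hκ₁κ hκ1 => closesEchoDecayAt ν M κ hν (hκ₁.trans hκ₁κ) (hres κ hκ₁κ hκ1)⟩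

/-- The echo residue in the time class implies the one in the decay class (fewer profiles). -/
theorem echoResidueDecay_of_echoResidue (κ : ℝ) (h : EchoResidue κ) : EchoResidueDecay κ :=
  fun _ C v hrate _ hcont hmild hdiv hsym => h C v hrate hcont hmild hdiv hsym


end Summit.NavierStokesRegularity.NavierStokesRegularity.Theorems.PeepholeEchoDoorDoors

end
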